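import Literature.Probability.RandomPlanarGeometry.HexSAWHopfPath
import HarnessLib

/-!
# Mode form of the parafermionic weights at a vertex: prolongations are twisted multiples of first arrivals

Topic `Literature/Probability/RandomPlanarGeometry`; a corollary file of `HexSAWObservable.lean` (the
coordinate model `HV` of the honeycomb lattice, mid-edge walks from the standard entrance `wOut ∉ V`,
parafermionic weights `pwt P = x_c^{ℓ} λ^{pturn}` at `x = x_c`, `σ = 5/8`). Source: H. Duminil-Copin,
S. Smirnov, *The connective constant of the honeycomb lattice equals `√(2+√2)`*, Ann. of Math. 175
(2012), 1653–1665 (arXiv:1007.0575), §2, proof of Lemma 1: "walks visiting one or two mid-edges can be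
grouped in triplets" — every walk whose final half-edge LEAVES the vertex `v` (class `clsOut V v`) is
the one-step prolongation of a unique walk arriving at `v` for the first time (class `clsIn V v`,
`sum_clsOut_eq`), with one more vertex and one more turn `∓π/3` ("`W_{γ₂}(a,q) = W_{γ₁}(a,p) ∓ π/3`").

DCS use this grouping with the direction weights `(p - v)` to obtain the vertex relation (the
coefficient `1 + x_c(jλ̄ + j̄λ)` vanishes, `triplet_identity`). The SAME grouping with the two other
characters of `ℤ/3` gives the identities recorded here, which are what a flattening / no-fold
analysis of the observable at a vertex rests on (the "sum mode" and the "Beltrami mode" of the three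
mid-edge values around `v` are, up to the walks that pass through `v` and come back, FIXED complex
multiples of the corresponding modes of the FIRST ARRIVALS):

* `pwt_append_ccw`, `pwt_append_cw`: the two prolongations of a first arrival `P` weigh
  `x_c λ⁻¹ · pwt P` and `x_c λ · pwt P`;
* **`sum_clsOut_pwt`** (trivial character): `Σ_{clsOut} pwt = x_c (λ + λ⁻¹) · Σ_{clsIn} pwt`, and
  `lam_add_lam_inv : λ + λ⁻¹ = 2 cos(5π/24)` — so the sum of the three mid-edge values at `v` over
  first arrivals and their prolongations is `(1 + 2 x_c cos(5π/24)) Σ_{clsIn} pwt = 1.8587… · Σ_{clsIn} pwt`;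
* **`sum_clsOut_inv_edir_pwt`** (conjugate-direction character, weights `(edir v ·)⁻¹`):
  `Σ_{Q ∈ clsOut} (edir v (finalDart Q).2)⁻¹ pwt Q = x_c (λ⁻¹⁷ - λ⁻⁷) · Σ_{P ∈ clsIn} (edir v (finalDart P).1)⁻¹ pwt P`,
  and `lam_B : λ⁻¹⁷ - λ⁻⁷ = 2 cos(11π/24)` — coefficient `1 + 2 x_c cos(11π/24) = 1.1413…`;
* for comparison, with the direction character `edir v ·` itself the coefficient is
  `1 + x_c(ω²λ⁻¹ - ωλ) = 1 + 2x_c cos(157.5°) = 0` (`triplet_identity`, `sum_clsIn_add_clsOut`).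

The quotient of the two surviving coefficients, `(1 + 2x_c cos(11π/24)) / (1 + 2x_c cos(5π/24)) = 0.6140…`,
is the Beltrami quotient `‖F₀ + ωF₁ + ω²F₂‖ / ‖F₀ + F₁ + F₂‖` (clockwise labelling) of any domain in
which every walk reaches the three mid-edges of `v` through a single first-arrival class (e.g. the
one-vertex domain). Deliberately NOT here: the transport to `hexParafermionicObservable` (see
`HexParafermionProofs.hexParafermionicObservable_eq_sum_pwt`) and anything about the loop class `clsLoop`.
-/

noncomputable section

open Finset

namespace Literature.Probability.RandomPlanarGeometry.SAW

namespace HV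

variable {V : Finset HV} {P : List HV} {v : HV}

/-! ### The two prolongations of a first arrival -/

/-- A first arrival at `v` (class `clsIn`): a mid-edge walk with final dart `(s, v)`, `v` not an
inner vertex. [cite: DuminilCopinSmirnov2012, proof of Lemma 1] -/
theorem mem_clsIn_iff : P ∈ clsIn V v ↔ IsMidWalk V P ∧ (finalDart P).2 = v ∧ v ∉ inner P := by
  rw [clsIn, mem_filter, mem_midWalks_iff]

/-- The final dart of a first arrival at `v` arrives along an edge `v ∼ s`. [folklore] -/
theorem adj_of_mem_clsIn (hP : P ∈ clsIn V v) : hvGraph.Adj v (finalDart P).1 := by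
  obtain ⟨hW, hv, -⟩ := mem_clsIn_iff.1 hP
  exact hv ▸ hW.adj_finalDart.symm

/-- **The counterclockwise prolongation of a first arrival** weighs `x_c λ⁻¹` times the arrival (one
more vertex, one right turn) and its final dart is `(v, ccw v s)`.
[cite: DuminilCopinSmirnov2012, proof of Lemma 1 ("W_{γ₂}(a,q) = W_{γ₁}(a,p) ∓ π/3")] -/
theorem pwt_append_ccw (hvV : v ∈ V) (hP : P ∈ clsIn V v) :
    pwt (P ++ [ccw v (finalDart P).1]) = (hexCriticalFugacity : ℂ) * lam ^ (-1 : ℤ) * pwt P ∧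
      finalDart (P ++ [ccw v (finalDart P).1]) = (v, ccw v (finalDart P).1) := by
  obtain ⟨hW, hv, hvi⟩ := mem_clsIn_iff.1 hP
  have ht : hvGraph.Adj v (finalDart P).1 := adj_of_mem_clsIn hP
  obtain ⟨-, f₁, m₁, -⟩ := hW.append_singleton hv hvV hvi (adj_ccw v _) (ccw_ne v _)
  have p₁ := hW.pturn_append_singleton (ccw v (finalDart P).1)
  rw [hv, turn_ccw ht] at p₁
  refine ⟨?_, f₁⟩
  simp only [pwt, m₁, p₁, pow_succ, zpow_add₀ lam_ne_zero, zpow_neg_one]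
  ring

/-- **The clockwise prolongation of a first arrival** weighs `x_c λ` times the arrival (one more
vertex, one left turn) and its final dart is `(v, cw v s)`.
[cite: DuminilCopinSmirnov2012, proof of Lemma 1 ("W_{γ₂}(a,q) = W_{γ₁}(a,p) ∓ π/3")] -/
theorem pwt_append_cw (hvV : v ∈ V) (hP : P ∈ clsIn V v) :
    pwt (P ++ [cw v (finalDart P).1]) = (hexCriticalFugacity : ℂ) * lam * pwt P ∧
      finalDart (P ++ [cw v (finalDart P).1]) = (v, cw v (finalDart P).1) := by
  obtain ⟨hW, hv, hvi⟩ := mem_clsIn_iff.1 hP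
  have ht : hvGraph.Adj v (finalDart P).1 := adj_of_mem_clsIn hP
  obtain ⟨-, f₂, m₂, -⟩ := hW.append_singleton hv hvV hvi (adj_cw v _) (cw_ne ht)
  have p₂ := hW.pturn_append_singleton (cw v (finalDart P).1)
  rw [hv, turn_cw ht] at p₂
  refine ⟨?_, f₂⟩
  simp only [pwt, m₂, p₂, pow_succ, zpow_add₀ lam_ne_zero, zpow_one]
  ring

/-! ### The trivial character: the sum mode -/

/-- **Sum mode of the prolongations**: `Σ_{clsOut} pwt = x_c (λ + λ⁻¹) Σ_{clsIn} pwt`.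
[cite: DuminilCopinSmirnov2012, proof of Lemma 1 (grouping in triplets)] -/
theorem sum_clsOut_pwt (hw : wOut ∉ V) (hvV : v ∈ V) :
    ∑ Q ∈ clsOut V v, pwt Q =
      (hexCriticalFugacity : ℂ) * (lam + lam ^ (-1 : ℤ)) * ∑ P ∈ clsIn V v, pwt P := by
  rw [sum_clsOut_eq hw hvV, mul_sum]
  refine sum_congr rfl fun P hP => ?_
  rw [(pwt_append_ccw hvV hP).1, (pwt_append_cw hvV hP).1]
  ring

/-- `λ + λ⁻¹ = 2 cos(5π/24)` (`= 1.5867…`; so `1 + x_c(λ + λ⁻¹) = 1.8587…`). [folklore] -/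
theorem lam_add_lam_inv : lam + lam ^ (-1 : ℤ) = ((2 * Real.cos (5 * Real.pi / 24) : ℝ) : ℂ) := by
  have h1 : lam = lam ^ (1 : ℤ) := (zpow_one lam).symm
  apply Complex.ext
  · rw [Complex.add_re, h1, ← zpow_mul, lam_zpow_re, lam_zpow_re, Complex.ofReal_re]
    push_cast
    rw [show (1 : ℝ) * θ₅ = -(5 * Real.pi / 24) by simp only [θ₅]; ring,
      show (-1 : ℝ) * θ₅ = 5 * Real.pi / 24 by simp only [θ₅]; ring, Real.cos_neg]
    ring
  · rw [Complex.add_im, h1, ← zpow_mul, lam_zpow_im, lam_zpow_im, Complex.ofReal_im]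
    push_cast
    rw [show (1 : ℝ) * θ₅ = -(5 * Real.pi / 24) by simp only [θ₅]; ring,
      show (-1 : ℝ) * θ₅ = 5 * Real.pi / 24 by simp only [θ₅]; ring, Real.sin_neg]
    ring

/-! ### The conjugate-direction character: the Beltrami mode -/

/-- **Conjugate-direction mode of the prolongations** (weights `(edir v ·)⁻¹`, i.e. `ω^{-j}` on the
`j`-th neighbour counterclockwise, up to the common unit `edir v t₀`):
`Σ_{Q ∈ clsOut} (edir v (finalDart Q).2)⁻¹ pwt Q = x_c (λ⁻¹⁷ - λ⁻⁷) Σ_{P ∈ clsIn} (edir v (finalDart P).1)⁻¹ pwt P`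
(`ω = λ⁸`, `edir v (ccw v s) = ω² edir v s`, `edir v (cw v s) = -ω edir v s`).
[cite: DuminilCopinSmirnov2012, proof of Lemma 1 (grouping in triplets)] -/
theorem sum_clsOut_inv_edir_pwt (hw : wOut ∉ V) (hvV : v ∈ V) :
    ∑ Q ∈ clsOut V v, (edir v (finalDart Q).2)⁻¹ * pwt Q =
      (hexCriticalFugacity : ℂ) * (lam ^ (-17 : ℤ) - lam ^ (-7 : ℤ)) *
        ∑ P ∈ clsIn V v, (edir v (finalDart P).1)⁻¹ * pwt P := by
  rw [sum_clsOut_eq hw hvV, mul_sum]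
  refine sum_congr rfl fun P hP => ?_
  have ht : hvGraph.Adj v (finalDart P).1 := adj_of_mem_clsIn hP
  have he : edir v (finalDart P).1 ≠ 0 := edir_ne_zero ht
  obtain ⟨w₁, f₁⟩ := pwt_append_ccw hvV hP
  obtain ⟨w₂, f₂⟩ := pwt_append_cw hvV hP
  rw [w₁, w₂, f₁, f₂]
  simp only [edir_ccw ht, edir_cw ht]
  have homg : omg = lam ^ (8 : ℤ) := lam_zpow_eight.symm
  have e17 : lam ^ (-17 : ℤ) = (omg ^ 2)⁻¹ * lam ^ (-1 : ℤ) := by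
    rw [homg, ← zpow_natCast, ← zpow_mul, ← zpow_neg, ← zpow_add₀ lam_ne_zero]; norm_num
  have e7 : lam ^ (-7 : ℤ) = omg⁻¹ * lam := by
    rw [homg, ← zpow_neg, ← zpow_add_one₀ lam_ne_zero]; norm_num
  rw [e17, e7, mul_inv, inv_neg]
  ring

/-- `λ⁻¹⁷ - λ⁻⁷ = 2 cos(11π/24)` (`= 0.2610…`; so `1 + x_c(λ⁻¹⁷ - λ⁻⁷) = 1.1413…`): `-17 θ₅ = 85π/24 ≡ -11π/24`
and `-7 θ₅ = 35π/24 = 11π/24 + π`. [folklore] -/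
theorem lam_B : lam ^ (-17 : ℤ) - lam ^ (-7 : ℤ) = ((2 * Real.cos (11 * Real.pi / 24) : ℝ) : ℂ) := by
  have a17 : ((-17 : ℤ) : ℝ) * θ₅ = -(11 * Real.pi / 24) + 2 * Real.pi + 2 * Real.pi := by
    simp only [θ₅]; push_cast; ring
  have a7 : ((-7 : ℤ) : ℝ) * θ₅ = 11 * Real.pi / 24 + Real.pi := by
    simp only [θ₅]; push_cast; ring
  apply Complex.ext
  · rw [Complex.sub_re, lam_zpow_re, lam_zpow_re, Complex.ofReal_re, a17, a7, Real.cos_add_two_pi,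
      Real.cos_add_two_pi, Real.cos_neg, Real.cos_add_pi]
    ring
  · rw [Complex.sub_im, lam_zpow_im, lam_zpow_im, Complex.ofReal_im, a17, a7, Real.sin_add_two_pi,
      Real.sin_add_two_pi, Real.sin_neg, Real.sin_add_pi]
    ring

/-- **The singleton quotient**: the ratio of the two surviving triplet coefficients,
`(1 + 2x_c cos(11π/24)) / (1 + 2x_c cos(5π/24))`, is a real number in `(0, 1)` — the Beltrami quotient
of every first-arrival class taken alone. Here only the elementary bounds `0 < … < 1` from
`0 < cos(11π/24) < cos(5π/24)` and `0 < x_c`. [folklore] -/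
theorem singleton_quotient_pos_lt_one :
    0 < (1 + 2 * hexCriticalFugacity * Real.cos (11 * Real.pi / 24)) /
        (1 + 2 * hexCriticalFugacity * Real.cos (5 * Real.pi / 24)) ∧
      (1 + 2 * hexCriticalFugacity * Real.cos (11 * Real.pi / 24)) /
        (1 + 2 * hexCriticalFugacity * Real.cos (5 * Real.pi / 24)) < 1 := by
  have hx : 0 < hexCriticalFugacity := by
    rw [hexCriticalFugacity]; positivity
  have h11 : 0 < Real.cos (11 * Real.pi / 24) := by
    apply Real.cos_pos_of_mem_Ioo; constructor <;> linarith [Real.pi_pos]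
  have h5 : 0 < Real.cos (5 * Real.pi / 24) := by
    apply Real.cos_pos_of_mem_Ioo; constructor <;> linarith [Real.pi_pos]
  have hlt : Real.cos (11 * Real.pi / 24) < Real.cos (5 * Real.pi / 24) := by
    apply Real.cos_lt_cos_of_nonneg_of_le_pi_div_two <;> linarith [Real.pi_pos]
  have hden : 0 < 1 + 2 * hexCriticalFugacity * Real.cos (5 * Real.pi / 24) := by positivity
  constructor
  · positivity
  · rw [div_lt_one hden]
    nlinarith

end HV

end Literature.Probability.RandomPlanarGeometry.SAW

end
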